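import Summits.BirchSwinnertonDyer.BirchSwinnertonDyer.Theorems.EisensteinPrimesXAcImprimitiveNoPTorsion
import Summits.BirchSwinnertonDyer.BirchSwinnertonDyer.Theorems.EisensteinPrimesGrSelmerImprimitiveLambdaShift
import Literature.NumberTheory.EllipticCurves.CastellaGrossiLeeSkinner2022.CharacterGreenbergSelmerLambdaRelaxation
import HarnessLib

/-!
# [PWL-θ] in the STRICT currency: `λ(𝔛^{Sf}_θ) = λ(𝔛_θ) + corank` and `λ(𝔛_θ) + Σ_{w∈Sf} λ(𝒫_w(θ)) ≤ λ(𝔛^{Sf}_θ)` for the two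
# residual characters at every NON-SPLIT multiplicative Eisenstein datum, modulo CGLS22 Prop. 1.2.5 BY NAME; composed with
# [ALG-imp] (g7): `λ(𝔛_{θsub}) + λ(𝔛_{θquot}) + Σ_{w∈Sf} (λ𝒫_w(θsub) + λ𝒫_w(θquot)) ≤ λ(𝔛^{Sf}_f)` modulo PUBLISHED facts only
# (cell `bsd-eis`, width seat `bsd-line-x2-p2` gen 8; crux 4 `BSDpOnCellC` stmt-BirchSwinnertonDyer-19034, line b1 v12 UNCHANGED)

WHY. After g6 (p643997/p644365) and g7 (p654300) the algebraic third [ALG-imp] of line b1's wall `stub_imprimitiveCount` at a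
non-split `p ‖ N` is kernel modulo PUBLISHED facts in CGLS's `𝓕_Gr` currency: `λ(𝔛^{Sf}_f) = λ(Dsub.X) + λ(Dquot.X)` for ANY strict
dual data `Dsub`, `Dquot : KellerYin2024.GrDualData … ↑Sf γ` of the two residual characters. The wall compares `λ(𝔛^{Sf}_f)` with
`λ(𝓛^{BDP}) + Σ_{w∈Sf} λ𝒫_w(f)`; on the Greenberg–Vatsal / CGLS road the next step is the character-side `S`-RELAXATION [PWL-θ]
`λ(𝔛^{Sf}_θ) = λ(𝔛_θ) + Σ_{w∈Sf} λ(𝒫_w(θ))` (CGLS Prop. 1.2.5, λ-clause), which takes the count down to the PRIMITIVE character duals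
`𝔛_θ` — the objects of Rubin's main conjecture. This file proves it in the kernel modulo two PUBLISHED named facts of CGLS Prop. 1.2.5
(module/dimension clauses `prop125_characterGrSelmerDual_torsion_muZero_dim`, g6 p642385; corank clause
`prop125_characterGrSelmerDual_corank_ge`, this seat), using the generic λ-shift `GrSelmerImprimitiveLambdaShift` (this seat, p657642).

WHAT.
* §1 `charLambdaRelaxation_of_facts` — CHARACTER level, binders those of the two named facts: for ANY strict dual data `DS` (at `↑S`)
  and `D0` (at `∅`): `D0.X` finitely generated, `Λ`-torsion, `μ = 0`; `λ(DS.X) = λ(D0.X) + corank_{ℤ_p}(H¹_{𝓕_Gr^S}/H¹_{𝓕_Gr})`;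
  and `λ(D0.X) + Σ_{w∈S} charLocalLambda ∅ κ θ w ≤ λ(DS.X)`.
* §2 `charHypotheses_of_not_split` — at a NON-SPLIT multiplicative Eisenstein datum (`W/ℚ` globally minimal, `2 < p`, `Mult`, not
  split, `K` imaginary quadratic Heegner for `N_E`, `(p)` split, `v̄ ∋ p`, `Sf` = places over `N_E` off `p`) every residual pair
  `(θsub, θquot)` of `E_K[p]` satisfies ALL character-level binders of the two facts at `S = Sf` (Teichmüller values; `Sf` prime to `p`
  over split primes; residual characters unramified outside `Sf ∪ {w ∣ p}`; `D_{v̄}` neither trivial nor cyclotomic on either —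
  the Tate-curve lemma `localData_of_not_split`, g6); `charLambdaRelaxation_of_not_split_of_facts` — §1 at such a datum for
  `θ ∈ {θsub, θquot}`.
* §3 `lambdaInvariant_xAc_eq_add_add_zpCorank_of_not_split_of_facts` / `add_add_sum_le_lambdaInvariant_xAc_of_not_split_of_facts` —
  composed with g7's `XAcImprimitiveNoPTorsion.lambdaInvariant_xAc_eq_add_of_not_split_of_facts`:
  `λ(𝔛^{Sf}_f) = λ(D0sub.X) + λ(D0quot.X) + corank_sub + corank_quot` and
  **`λ(D0sub.X) + λ(D0quot.X) + Σ_{w∈Sf} (charLocalLambda θsub w + charLocalLambda θquot w) ≤ λ(𝔛^{Sf}_f)`** — [ALG-imp] + [PWL-θ] in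
  ONE currency, conditional BY NAME on PUBLISHED facts only: CGLS22 ×5 (Prop. 1.2.5 module/dim + corank, Prop. 14 finiteness,
  Cor. 1.2.6 ×2) + Greenberg ×4 (2016 Prop. 4.1.1, 2006 Props. 4.1/4.2/3.2).

HONEST FRAMING: tool/assembly theorems only (no definition, no new named fact HERE, no `sorry`); every `(h : <named fact>)` is a
PUBLISHED statement taken BY NAME (conditional results). Nothing here closes a stub of v12: what remains of the wall at non-split
`p ‖ N` after this file is [BR] (Rubin's main conjecture `λ(𝔛_θ) = λ(𝓛_θ)`, PUB) and the analytic comparison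
`λ(𝓛^{BDP}_𝔭(f)) + Σ λ𝒫_w(f) = λ(𝓛_φ) + λ(𝓛_ψ) + Σ(λ𝒫_w(φ) + λ𝒫_w(ψ))` (CGLS Thm. 2.2.2 shape; UNPRINTED at `p ‖ N`), plus the
other stubs. BSD / Mazur's MC / IMC is proved for no curve; 0 cells / labels / stubs / tiers move.

References: [CastellaGrossiLeeSkinner2022] §1.1 Lemma 1.1.1, §1.2 Prop. 1.2.5 and proof (eq:sur2), Cor. 1.2.6, §1.4 (Invent. Math. 227
(2022); arXiv:2008.02571 Prop. 14, Cor. 15); [GreenbergVatsal2000] §2 Cor. (2.3), Prop. (2.4); [PollackWeston2011] Prop. A.2;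
[KellerYin2024] Thm. 1.4.1, Prop. 1.2.5, Lemma 5.1.1 (arXiv:2402.12781v2); [Greenberg2016Selmer] Prop. 4.1.1; [Greenberg2006] Props. 3.2,
4.1, 4.2.
-/

set_option autoImplicit false
set_option linter.dupNamespace false -- the summit namespace `…BirchSwinnertonDyer.BirchSwinnertonDyer.Theorems` (Sub = Summit, D-0017) trips it

noncomputable section

open scoped Classical
open NumberField IsDedekindDomain Field WeierstrassCurve
open Literature.NumberTheory.EllipticCurves Literature.NumberTheory.EllipticCurves.GreenbergSelmer
  Literature.NumberTheory.EllipticCurves.GreenbergVatsal2000 Literature.NumberTheory.GaloisRepresentations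
  Literature.NumberTheory.EllipticCurves.KellerYin2024 Literature.NumberTheory.EllipticCurves.IwasawaAlgebra
  Literature.NumberTheory.EllipticCurves.Castella2018.AcSelmer Literature.NumberTheory.EllipticCurves.Rank1Residual
  Literature.NumberTheory.EllipticCurves.CastellaGrossiLeeSkinner2022
  Literature.NumberTheory.IwasawaTheory Literature.NumberTheory.IwasawaTheory.Greenberg2016
  Literature.NumberTheory.IwasawaTheory.Greenberg2006
  Summit.BirchSwinnertonDyer.Rank1Residual.X2.ResidualDevissageModules
  Summit.BirchSwinnertonDyer.BirchSwinnertonDyer.Theorems.ResidualDevissageNonsplitLocalData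
  Summit.BirchSwinnertonDyer.BirchSwinnertonDyer.Theorems.ResidualDevissageNonsplitLambdaIdentityOfFacts
  Summit.BirchSwinnertonDyer.BirchSwinnertonDyer.Theorems.ResidualDevissageNonsplitLambdaIdentityAtNonsplit
  Summit.BirchSwinnertonDyer.BirchSwinnertonDyer.Theorems.CumulativeHeegnerInclusionAtThreeResidualDevissage

namespace Summit.BirchSwinnertonDyer.BirchSwinnertonDyer.Theorems.CharGrSelmerLambdaRelaxation

variable {p : ℕ} [hp : Fact p.Prime]

/-! ## §1 Character level: the `S`-relaxation of the strict duals, modulo CGLS Prop. 1.2.5 by name -/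

/-- **[PWL-θ] in the strict currency, CHARACTER level** — for `θ : Γ_K → GL₁(𝒪_{ℚ_p})` Teichmüller-valued over an imaginary
quadratic `K` with `(p)` split (`p` odd), `κ` anticyclotomic with topological generator `γ`, `𝔭 = v̄ ∋ p`, `S` a finite set of places
prime to `p` over split rational primes outside which (and outside `p`) the residual character is unramified, `D_𝔭` neither trivial
nor cyclotomic on `(F/𝒪)(θ)[p]` («`θ|_{G_v̄} ≠ 𝟙, ω`»), and ANY strict dual data `DS` of `H¹_{𝓕_Gr^S}(K_∞, (F/𝒪)(θ))` and `D0` of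
`H¹_{𝓕_Gr}(K_∞, (F/𝒪)(θ))`: GRANTED CGLS Prop. 1.2.5 BY NAME (module clause at `S`; corank clause), `D0.X` is finitely generated
`Λ`-torsion with `μ = 0`, `λ(DS.X) = λ(D0.X) + corank_{ℤ_p}(H¹_{𝓕_Gr^S}/H¹_{𝓕_Gr})` (kernel: `GrSelmerImprimitiveLambdaShift`), and
`λ(D0.X) + Σ_{w∈S} λ(𝒫_w(θ)) ≤ λ(DS.X)` (`λ(𝒫_w(θ))` = `charLocalLambda`). CGLS: «`λ(𝔛_θ^S) = λ(𝔛_θ) + Σ_{w∈Σ, w∤p} λ(𝒫_w(θ))`».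
[cite: CastellaGrossiLeeSkinner2022, §1.2 Prop. 1.2.5 and proof (eq:sur2), Lemma 1.1.1 (arXiv:2008.02571 Prop. 14, Lemma 9)]
[cite: GreenbergVatsal2000, §2 Cor. (2.3) and Prop. (2.4)] -/
theorem charLambdaRelaxation_of_facts
    (hprop125 : prop125_characterGrSelmerDual_torsion_muZero_dim) (hge : prop125_characterGrSelmerDual_corank_ge)
    (K : Type) [Field K] [NumberField K] (hK : IsImaginaryQuadratic K) (hp2 : p ≠ 2)
    (hsplit : ((Ideal.span {(p : ℤ)}).primesOver (𝓞 K)).ncard = 2)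
    (κ : ZpExtension K p) (hκ : κ.IsAnticyclotomic) (γ : absoluteGaloisGroup K) (hγ : κ.IsTopGenerator γ)
    (vbar : HeightOneSpectrum (𝓞 K)) (hvbar : ((p : ℕ) : 𝓞 K) ∈ vbar.asIdeal)
    (θ : FramedGaloisRep K (padicCoeffIntegers (∅ : Set (PadicAlgCl p))) 1)
    (hθ : ∀ σ : absoluteGaloisGroup K, θ σ ^ (p - 1) = 1)
    (S : Finset (HeightOneSpectrum (𝓞 K)))
    (hSmem : ∀ v ∈ S, ((p : ℕ) : 𝓞 K) ∉ v.asIdeal ∧ ((v.asIdeal.under ℤ).primesOver (𝓞 K)).ncard = 2)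
    (hunr : ∀ v : HeightOneSpectrum (𝓞 K), v ∉ S → ((p : ℕ) : 𝓞 K) ∉ v.asIdeal →
      ∀ x ∈ inertia v, ∀ m : charModule (∅ : Set (PadicAlgCl p)) θ, p • m = 0 → x • m = m)
    (hne1 : ¬ ∀ g ∈ decomp vbar, ∀ m : charModule (∅ : Set (PadicAlgCl p)) θ, p • m = 0 → g • m = m)
    (hneω : ¬ ∀ g ∈ decomp vbar, ∀ m : charModule (∅ : Set (PadicAlgCl p)) θ, p • m = 0 →
      g • m = ((modNCyclotomicCharacter K p g : (ZMod p)ˣ) : ZMod p).val • m)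
    (DS : GrDualData κ (charModule (∅ : Set (PadicAlgCl p)) θ) vbar (↑S : Set (HeightOneSpectrum (𝓞 K))) γ)
    (D0 : GrDualData κ (charModule (∅ : Set (PadicAlgCl p)) θ) vbar (∅ : Set (HeightOneSpectrum (𝓞 K))) γ) :
    Module.Finite (IwasawaAlgebra p) D0.X ∧ Module.IsTorsion (IwasawaAlgebra p) D0.X ∧ muInvariant p D0.X = 0 ∧
      lambdaInvariant p DS.X = lambdaInvariant p D0.X +
        zpCorank (↥(grSelmer κ (charModule (∅ : Set (PadicAlgCl p)) θ) vbar (↑S : Set (HeightOneSpectrum (𝓞 K)))) ⧸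
          (grSelmer κ (charModule (∅ : Set (PadicAlgCl p)) θ) vbar (∅ : Set (HeightOneSpectrum (𝓞 K)))).addSubgroupOf
            (grSelmer κ (charModule (∅ : Set (PadicAlgCl p)) θ) vbar (↑S : Set (HeightOneSpectrum (𝓞 K))))) p ∧
      lambdaInvariant p D0.X + ∑ w ∈ S, charLocalLambda (∅ : Set (PadicAlgCl p)) κ θ w ≤ lambdaInvariant p DS.X := by
  have hSmem' : ∀ v ∈ (↑S : Set (HeightOneSpectrum (𝓞 K))), ((p : ℕ) : 𝓞 K) ∉ v.asIdeal ∧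
      ((v.asIdeal.under ℤ).primesOver (𝓞 K)).ncard = 2 := fun v hv ↦ hSmem v (Finset.mem_coe.mp hv)
  have hunr' : ∀ v : HeightOneSpectrum (𝓞 K), v ∉ (↑S : Set (HeightOneSpectrum (𝓞 K))) → ((p : ℕ) : 𝓞 K) ∉ v.asIdeal →
      ∀ x ∈ inertia v, ∀ m : charModule (∅ : Set (PadicAlgCl p)) θ, p • m = 0 → x • m = m :=
    fun v hv ↦ hunr v (fun h ↦ hv (Finset.mem_coe.mpr h))
  obtain ⟨hfg, hT, hμ, -⟩ := hprop125 K p hK hp2 hsplit κ hκ γ hγ vbar hvbar θ hθ (↑S : Set (HeightOneSpectrum (𝓞 K)))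
    S.finite_toSet hSmem' hunr' hne1 hneω DS
  haveI := hfg
  obtain ⟨hfg0, hT0, hμ0, -, hlam⟩ :=
    GrSelmerImprimitiveLambdaShift.lambdaInvariant_eq_add_zpCorank_of_muInvariant_eq_zero κ vbar
      (exists_pow_smul_cofree_eq_zero (∅ : Set (PadicAlgCl p)) θ) (isOpen_stabilizer_cofree (∅ : Set (PadicAlgCl p)) θ) hγ
      (Set.empty_subset (↑S : Set (HeightOneSpectrum (𝓞 K)))) DS hT hμ D0
  -- restate the λ-shift with the quotient spelled through `charModule` (an `abbrev` of `Cofree`), so that `omega` sees one atom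
  have hlam' : lambdaInvariant p DS.X = lambdaInvariant p D0.X +
      zpCorank (↥(grSelmer κ (charModule (∅ : Set (PadicAlgCl p)) θ) vbar (↑S : Set (HeightOneSpectrum (𝓞 K)))) ⧸
        (grSelmer κ (charModule (∅ : Set (PadicAlgCl p)) θ) vbar (∅ : Set (HeightOneSpectrum (𝓞 K)))).addSubgroupOf
          (grSelmer κ (charModule (∅ : Set (PadicAlgCl p)) θ) vbar (↑S : Set (HeightOneSpectrum (𝓞 K))))) p := hlam
  have hc := hge K p hK hp2 hsplit κ hκ vbar hvbar θ hθ S hSmem hunr hne1 hneω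
  exact ⟨hfg0, hT0, hμ0, hlam', by omega⟩

/-! ## §2 At a NON-SPLIT multiplicative Eisenstein datum, for the two residual characters -/

/-- **Every residual pair of `E_K[p]` at a non-split multiplicative Eisenstein datum satisfies the character-level binders of CGLS
§1.2 at `S = Sf`** (`W/ℚ` globally minimal, `2 < p`, `p ‖ N` NON-SPLIT, `K` imaginary quadratic with the Heegner hypothesis for
`N_E`, `(p)` split, `v̄ ∋ p`, `Sf` = the places of `K` over `N_E` not over `p`): both characters are Teichmüller-valued; `Sf` is prime
to `p` over split rational primes; both residual characters are unramified outside `Sf ∪ {w ∣ p}` (good reduction of `E` there); and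
`D_{v̄}` fixes neither `(F/𝒪)(θsub)[p]` nor `(F/𝒪)(θquot)[p]` pointwise and acts on neither through `ω` (Tate curve at a NON-SPLIT
`p`: both graded characters are `ωχ`, `χ` with `χ` the non-trivial unramified quadratic character — g6's `localData_of_not_split`).
Assembly of g6's transfer lemmas along the stable line of the pair. [cite: CastellaGrossiLeeSkinner2022, §1.2 (standing hypotheses on θ) and Prop. 1.2.5]
[cite: SilvermanATAEC1994, Ch. V Thm. 5.3, Cor. 5.4] [cite: KellerYin2024, §1.4 display (char to f), Lemma 5.1.1 (arXiv:2402.12781v2)] -/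
theorem charHypotheses_of_not_split (W : WeierstrassCurve ℚ) [W.IsElliptic] [W.IsGloballyMinimal]
    (K : Type) [Field K] [NumberField K] (vbar : HeightOneSpectrum (𝓞 K)) (κ : ZpExtension K p)
    (Sf : Finset (HeightOneSpectrum (𝓞 K)))
    (hp2 : 2 < p) (hmult : Mult W p) (hns : ¬ W.HasSplitMultiplicativeReductionAtPrime p)
    (hK : IsImaginaryQuadratic K) (hH : SatisfiesHeegnerHypothesis (W.conductorNorm ℤ) K)
    (hsplit : ((Ideal.span {(p : ℤ)}).primesOver (𝓞 K)).ncard = 2)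
    (hvbar : ((p : ℕ) : 𝓞 K) ∈ vbar.asIdeal)
    (hSf : ∀ w : HeightOneSpectrum (𝓞 K), w ∈ Sf ↔
      (((W.conductorNorm ℤ : ℤ) : 𝓞 K) ∈ w.asIdeal ∧ ((p : ℕ) : 𝓞 K) ∉ w.asIdeal))
    (θsub θquot : FramedGaloisRep K (padicCoeffIntegers (∅ : Set (PadicAlgCl p))) 1)
    (hpair : IsResidualPairOver (W.baseChange K) p θsub θquot) :
    (∀ v ∈ Sf, ((p : ℕ) : 𝓞 K) ∉ v.asIdeal ∧ ((v.asIdeal.under ℤ).primesOver (𝓞 K)).ncard = 2) ∧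
    ∀ θ : FramedGaloisRep K (padicCoeffIntegers (∅ : Set (PadicAlgCl p))) 1, (θ = θsub ∨ θ = θquot) →
      (∀ σ : absoluteGaloisGroup K, θ σ ^ (p - 1) = 1) ∧
      (∀ v : HeightOneSpectrum (𝓞 K), v ∉ Sf → ((p : ℕ) : 𝓞 K) ∉ v.asIdeal →
        ∀ x ∈ inertia v, ∀ m : charModule (∅ : Set (PadicAlgCl p)) θ, p • m = 0 → x • m = m) ∧
      (¬ ∀ g ∈ decomp vbar, ∀ m : charModule (∅ : Set (PadicAlgCl p)) θ, p • m = 0 → g • m = m) ∧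
      (¬ ∀ g ∈ decomp vbar, ∀ m : charModule (∅ : Set (PadicAlgCl p)) θ, p • m = 0 →
        g • m = ((modNCyclotomicCharacter K p g : (ZMod p)ˣ) : ZMod p).val • m) := by
  haveI hEK : (W.baseChange K).IsElliptic := inferInstanceAs (W.map (algebraMap ℚ K)).IsElliptic
  obtain ⟨hS₀mem, hgood⟩ := sf_split_and_good (p := p) W K Sf hH hSf
  -- the pair's stable line with its equivariant embeddings onto the `p`-torsion of the two character modules
  obtain ⟨S, hSub, -, ⟨jsub, hjsub, hjsub_inj, hjsub_range⟩, ⟨jquot, hjquot, hjquot_inj, hjquot_range⟩⟩ :=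
    ResidualPairStableLine.exists_stableLine_of_isResidualPairOver (W.baseChange K) hpair
  obtain ⟨-, hnon1, hnon2, hωS, hωQ, -⟩ := localData_of_not_split W K vbar κ hp2 hmult hns hK hsplit hvbar S hSub
  -- good reduction outside `Sf ∪ {w ∣ p}`: inertia acts trivially on `E_K[p]`, hence on the line and the quotient
  have hunrE : ∀ w : HeightOneSpectrum (𝓞 K), w ∉ (↑Sf : Set (HeightOneSpectrum (𝓞 K))) → ((p : ℕ) : 𝓞 K) ∉ w.asIdeal →
      ∀ x ∈ inertia w, ∀ m : (W.baseChange K).geomTorsion ((p : ℕ) : ℤ), x • m = m :=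
    fun w hw hpw x hx m ↦ smul_geomTorsion_eq_of_mem_inertia_chosen (W.baseChange K) (hgood w hw hpw) hpw hx m
  refine ⟨fun v hv ↦ hS₀mem v (Finset.mem_coe.mpr hv), fun θ hθ ↦ ?_⟩
  rcases hθ with rfl | rfl
  · refine ⟨fun σ ↦ (hpair.pow_sub_one σ).1, fun w hw hpw ↦ ?_, ?_, ?_⟩
    · exact (forall_smul_eq_iff_of_embedding θ jsub hjsub hjsub_inj hjsub_range (inertia w)).mp
        fun x hx a ↦ S.incl_injective (by
          rw [StableSubgroup.incl_smul]; exact hunrE w (fun h ↦ hw (Finset.mem_coe.mp h)) hpw x hx _)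
    · exact fun h ↦ hnon1 ((forall_smul_eq_iff_of_embedding θ jsub hjsub hjsub_inj hjsub_range (decomp vbar)).mpr h)
    · exact fun h ↦ hωS ((forall_smul_eq_cyclotomic_iff_of_embedding θ jsub hjsub hjsub_inj hjsub_range (decomp vbar)).mpr h)
  · refine ⟨fun σ ↦ (hpair.pow_sub_one σ).2, fun w hw hpw ↦ ?_, ?_, ?_⟩
    · exact (forall_smul_eq_iff_of_embedding θ jquot hjquot hjquot_inj hjquot_range (inertia w)).mp
        fun x hx a ↦ by
          obtain ⟨n, rfl⟩ := S.proj_surjective a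
          rw [StableSubgroup.smul_proj, hunrE w (fun h ↦ hw (Finset.mem_coe.mp h)) hpw x hx]
    · exact fun h ↦ hnon2 ((forall_smul_eq_iff_of_embedding θ jquot hjquot hjquot_inj hjquot_range (decomp vbar)).mpr h)
    · exact fun h ↦ hωQ ((forall_smul_eq_cyclotomic_iff_of_embedding θ jquot hjquot hjquot_inj hjquot_range (decomp vbar)).mpr h)

/-- **[PWL-θ] at a NON-SPLIT multiplicative Eisenstein datum, for either residual character `θ ∈ {θsub, θquot}`**, modulo CGLS
Prop. 1.2.5 BY NAME (module/dimension clause g6 p642385 + corank clause): for ANY strict dual data `DS` at `Sf` and `D0` at `∅`,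
`D0.X` is finitely generated `Λ`-torsion with `μ = 0`, `λ(DS.X) = λ(D0.X) + corank_{ℤ_p}(H¹_{𝓕_Gr^{Sf}}/H¹_{𝓕_Gr})`, and
**`λ(D0.X) + Σ_{w∈Sf} charLocalLambda ∅ κ θ w ≤ λ(DS.X)`** (datum: `W/ℚ` globally minimal, `2 < p`, `p ‖ N` non-split, `K` imaginary
quadratic Heegner for `N_E`, `(p)` split, `v̄ ∋ p`, `κ` anticyclotomic with generator `γ`, `Sf` = places over `N_E` off `p`). No local
hypothesis is left (§2's `charHypotheses_of_not_split`). CGLS Prop. 1.2.5: «`λ(𝔛_θ^S) = λ(𝔛_θ) + Σ_{w∈Σ, w∤p} λ(𝒫_w(θ))`».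
[cite: CastellaGrossiLeeSkinner2022, §1.2 Prop. 1.2.5 and proof (eq:sur2) (arXiv:2008.02571 Prop. 14)]
[cite: KellerYin2024, Prop. 1.2.5 and Lemma 5.1.1 (arXiv:2402.12781v2) (the 𝓕_nr twin / the datum)] -/
theorem charLambdaRelaxation_of_not_split_of_facts
    (hprop125 : prop125_characterGrSelmerDual_torsion_muZero_dim) (hge : prop125_characterGrSelmerDual_corank_ge)
    (W : WeierstrassCurve ℚ) [W.IsElliptic] [W.IsGloballyMinimal]
    (K : Type) [Field K] [NumberField K] (vbar : HeightOneSpectrum (𝓞 K))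
    (κ : ZpExtension K p) (γ : absoluteGaloisGroup K) [hγ : Fact (κ.IsTopGenerator γ)]
    (Sf : Finset (HeightOneSpectrum (𝓞 K)))
    (hp2 : 2 < p) (hmult : Mult W p) (hns : ¬ W.HasSplitMultiplicativeReductionAtPrime p)
    (hK : IsImaginaryQuadratic K) (hH : SatisfiesHeegnerHypothesis (W.conductorNorm ℤ) K)
    (hsplit : ((Ideal.span {(p : ℤ)}).primesOver (𝓞 K)).ncard = 2)
    (hvbar : ((p : ℕ) : 𝓞 K) ∈ vbar.asIdeal) (hκ : κ.IsAnticyclotomic)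
    (hSf : ∀ w : HeightOneSpectrum (𝓞 K), w ∈ Sf ↔
      (((W.conductorNorm ℤ : ℤ) : 𝓞 K) ∈ w.asIdeal ∧ ((p : ℕ) : 𝓞 K) ∉ w.asIdeal))
    (θsub θquot : FramedGaloisRep K (padicCoeffIntegers (∅ : Set (PadicAlgCl p))) 1)
    (hpair : IsResidualPairOver (W.baseChange K) p θsub θquot)
    (θ : FramedGaloisRep K (padicCoeffIntegers (∅ : Set (PadicAlgCl p))) 1) (hθ : θ = θsub ∨ θ = θquot)
    (DS : GrDualData κ (charModule (∅ : Set (PadicAlgCl p)) θ) vbar (↑Sf : Set (HeightOneSpectrum (𝓞 K))) γ)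
    (D0 : GrDualData κ (charModule (∅ : Set (PadicAlgCl p)) θ) vbar (∅ : Set (HeightOneSpectrum (𝓞 K))) γ) :
    Module.Finite (IwasawaAlgebra p) D0.X ∧ Module.IsTorsion (IwasawaAlgebra p) D0.X ∧ muInvariant p D0.X = 0 ∧
      lambdaInvariant p DS.X = lambdaInvariant p D0.X +
        zpCorank (↥(grSelmer κ (charModule (∅ : Set (PadicAlgCl p)) θ) vbar (↑Sf : Set (HeightOneSpectrum (𝓞 K)))) ⧸
          (grSelmer κ (charModule (∅ : Set (PadicAlgCl p)) θ) vbar (∅ : Set (HeightOneSpectrum (𝓞 K)))).addSubgroupOf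
            (grSelmer κ (charModule (∅ : Set (PadicAlgCl p)) θ) vbar (↑Sf : Set (HeightOneSpectrum (𝓞 K))))) p ∧
      lambdaInvariant p D0.X + ∑ w ∈ Sf, charLocalLambda (∅ : Set (PadicAlgCl p)) κ θ w ≤ lambdaInvariant p DS.X := by
  have hp2' : p ≠ 2 := by omega
  obtain ⟨hSmem, hchar⟩ := charHypotheses_of_not_split W K vbar κ Sf hp2 hmult hns hK hH hsplit hvbar hSf θsub θquot hpair
  obtain ⟨hθT, hunr, hne1, hneω⟩ := hchar θ hθ
  exact charLambdaRelaxation_of_facts hprop125 hge K hK hp2' hsplit κ hκ γ hγ.out vbar hvbar θ hθT Sf hSmem hunr hne1 hneω DS D0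

/-! ## §3 Composed with [ALG-imp] (g7): the primitive character duals bound `λ(𝔛^{Sf}_f)` from below -/

/-- **[ALG-imp] + [PWL-θ] at a NON-SPLIT multiplicative Eisenstein datum, modulo PUBLISHED facts BY NAME: `λ(𝔛^{Sf}_f) = λ(𝔛_{θsub}) +
λ(𝔛_{θquot}) + corank_sub + corank_quot`**, where `𝔛^{Sf}_f = XAc E_K p κ v̄ ↑Sf γ` (Keller–Yin's `𝔛^S_f`, Castella's strict
`Sf`-imprimitive dual), `𝔛_θ = D0θ.X` for ANY strict dual data at `∅` (CGLS's PRIMITIVE `𝔛_θ`), `corank_θ = corank_{ℤ_p}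
(H¹_{𝓕_Gr^{Sf}}/H¹_{𝓕_Gr})((F/𝒪)(θ))`; the datum as in g7's `lambdaInvariant_xAc_eq_add_of_not_split_of_facts` (with `v ∋ p`,
`v ≠ v̄`, `E[p]` reducible). Facts: CGLS22 Prop. 1.2.5 (module/dim; corank), Prop. 14 (finiteness), Cor. 1.2.6 (×2); Greenberg 2016
Prop. 4.1.1, 2006 Props. 4.1, 4.2, 3.2 — all PUBLISHED. [cite: CastellaGrossiLeeSkinner2022, §1.2 Prop. 1.2.5, Cor. 1.2.6, §1.4 Props. 1.4.1–1.4.2, Cor. 1.4.3]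
[cite: KellerYin2024, Thm. 1.4.1 and Prop. 1.2.5 (arXiv:2402.12781v2 TeX L1087–1098, L780–800)] [cite: Greenberg2016Selmer, Prop. 4.1.1]
[cite: Greenberg2006, Props. 3.2, 4.1, 4.2] -/
theorem lambdaInvariant_xAc_eq_add_add_zpCorank_of_not_split_of_facts
    (hprop125 : prop125_characterGrSelmerDual_torsion_muZero_dim) (hge : prop125_characterGrSelmerDual_corank_ge)
    (hfact : prop14_residualCharacterSelmer_finite)
    (hlift : cor126_residualCharacter_globalLift) (hlocal : cor126_residualCharacter_localSurjective)
    (h411 : prop411_selmer_isAlmostDivisible) (h41 : prop41_globalEulerPoincareCorank)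
    (h42 : prop42_localEulerPoincareCorank) (h32 : prop32_cohomology_isCofinitelyGenerated)
    (W : WeierstrassCurve ℚ) [W.IsElliptic] [W.IsGloballyMinimal]
    (K : Type) [Field K] [NumberField K] {v : HeightOneSpectrum (𝓞 K)} (vbar : HeightOneSpectrum (𝓞 K))
    (κ : ZpExtension K p) (γ : absoluteGaloisGroup K) [Fact (κ.IsTopGenerator γ)]
    (Sf : Finset (HeightOneSpectrum (𝓞 K)))
    (hp2 : 2 < p) (hmult : Mult W p) (hns : ¬ W.HasSplitMultiplicativeReductionAtPrime p) (hred : Red W p)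
    (hK : IsImaginaryQuadratic K) (hH : SatisfiesHeegnerHypothesis (W.conductorNorm ℤ) K)
    (hsplit : ((Ideal.span {(p : ℤ)}).primesOver (𝓞 K)).ncard = 2)
    (hv : ((p : ℕ) : 𝓞 K) ∈ v.asIdeal) (hvbar : ((p : ℕ) : 𝓞 K) ∈ vbar.asIdeal) (hne : vbar ≠ v) (hκ : κ.IsAnticyclotomic)
    (hSf : ∀ w : HeightOneSpectrum (𝓞 K), w ∈ Sf ↔
      (((W.conductorNorm ℤ : ℤ) : 𝓞 K) ∈ w.asIdeal ∧ ((p : ℕ) : 𝓞 K) ∉ w.asIdeal))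
    (θsub θquot : FramedGaloisRep K (padicCoeffIntegers (∅ : Set (PadicAlgCl p))) 1)
    (hpair : IsResidualPairOver (W.baseChange K) p θsub θquot)
    (Dsub : GrDualData κ (charModule (∅ : Set (PadicAlgCl p)) θsub) vbar (↑Sf : Set (HeightOneSpectrum (𝓞 K))) γ)
    (D0sub : GrDualData κ (charModule (∅ : Set (PadicAlgCl p)) θsub) vbar (∅ : Set (HeightOneSpectrum (𝓞 K))) γ)
    (Dquot : GrDualData κ (charModule (∅ : Set (PadicAlgCl p)) θquot) vbar (↑Sf : Set (HeightOneSpectrum (𝓞 K))) γ)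
    (D0quot : GrDualData κ (charModule (∅ : Set (PadicAlgCl p)) θquot) vbar (∅ : Set (HeightOneSpectrum (𝓞 K))) γ) :
    lambdaInvariant p (XAc (W.baseChange K) p κ vbar (↑Sf : Set (HeightOneSpectrum (𝓞 K))) γ) =
      lambdaInvariant p D0sub.X + lambdaInvariant p D0quot.X +
        zpCorank (↥(grSelmer κ (charModule (∅ : Set (PadicAlgCl p)) θsub) vbar (↑Sf : Set (HeightOneSpectrum (𝓞 K)))) ⧸
          (grSelmer κ (charModule (∅ : Set (PadicAlgCl p)) θsub) vbar (∅ : Set (HeightOneSpectrum (𝓞 K)))).addSubgroupOf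
            (grSelmer κ (charModule (∅ : Set (PadicAlgCl p)) θsub) vbar (↑Sf : Set (HeightOneSpectrum (𝓞 K))))) p +
        zpCorank (↥(grSelmer κ (charModule (∅ : Set (PadicAlgCl p)) θquot) vbar (↑Sf : Set (HeightOneSpectrum (𝓞 K)))) ⧸
          (grSelmer κ (charModule (∅ : Set (PadicAlgCl p)) θquot) vbar (∅ : Set (HeightOneSpectrum (𝓞 K)))).addSubgroupOf
            (grSelmer κ (charModule (∅ : Set (PadicAlgCl p)) θquot) vbar (↑Sf : Set (HeightOneSpectrum (𝓞 K))))) p := by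
  have halg := XAcImprimitiveNoPTorsion.lambdaInvariant_xAc_eq_add_of_not_split_of_facts hprop125 hfact hlift hlocal h411 h41 h42
    h32 W K vbar κ γ Sf hp2 hmult hns hred hK hH hsplit hv hvbar hne hκ hSf θsub θquot hpair Dsub Dquot
  obtain ⟨-, -, -, hsub, -⟩ := charLambdaRelaxation_of_not_split_of_facts hprop125 hge W K vbar κ γ Sf hp2 hmult hns hK hH hsplit
    hvbar hκ hSf θsub θquot hpair θsub (Or.inl rfl) Dsub D0sub
  obtain ⟨-, -, -, hquot, -⟩ := charLambdaRelaxation_of_not_split_of_facts hprop125 hge W K vbar κ γ Sf hp2 hmult hns hK hH hsplit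
    hvbar hκ hSf θsub θquot hpair θquot (Or.inr rfl) Dquot D0quot
  rw [halg, hsub, hquot]
  ring

/-- **The primitive character duals and the local Euler factors bound `λ(𝔛^{Sf}_f)` from below at a NON-SPLIT multiplicative
Eisenstein datum, modulo PUBLISHED facts BY NAME:
`λ(𝔛_{θsub}) + λ(𝔛_{θquot}) + Σ_{w∈Sf} (λ𝒫_w(θsub) + λ𝒫_w(θquot)) ≤ λ(𝔛^{Sf}_f)`** — [ALG-imp] (Keller–Yin Thm. 1.4.1 =
CGLS Prop. 1.4.x, g6/g7) + [PWL-θ] (CGLS Prop. 1.2.5, this file) in ONE currency. Datum and facts as in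
`lambdaInvariant_xAc_eq_add_add_zpCorank_of_not_split_of_facts`; `λ𝒫_w(θ) = charLocalLambda ∅ κ θ w`. What the wall
`stub_imprimitiveCount` of line b1 still needs at such a datum beyond this: Rubin's main conjecture `λ(𝔛_θ) = λ(𝓛_θ)` [PUB] and the
analytic comparison of CGLS Thm. 2.2.2's shape at `p ‖ N` [unprinted]. [cite: CastellaGrossiLeeSkinner2022, Prop. 1.2.5, Thm. 1.5.1 proof (eq:lambda-imp), Thm. 2.2.2, proof of Thm. 2.2.4]
[cite: KellerYin2024, Thm. 1.4.1, Thm. 1.5.1, Lemma 5.1.2 (arXiv:2402.12781v2)] [cite: GreenbergVatsal2000, §2 Prop. (2.4), §3] -/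
theorem add_add_sum_le_lambdaInvariant_xAc_of_not_split_of_facts
    (hprop125 : prop125_characterGrSelmerDual_torsion_muZero_dim) (hge : prop125_characterGrSelmerDual_corank_ge)
    (hfact : prop14_residualCharacterSelmer_finite)
    (hlift : cor126_residualCharacter_globalLift) (hlocal : cor126_residualCharacter_localSurjective)
    (h411 : prop411_selmer_isAlmostDivisible) (h41 : prop41_globalEulerPoincareCorank)
    (h42 : prop42_localEulerPoincareCorank) (h32 : prop32_cohomology_isCofinitelyGenerated)
    (W : WeierstrassCurve ℚ) [W.IsElliptic] [W.IsGloballyMinimal]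
    (K : Type) [Field K] [NumberField K] {v : HeightOneSpectrum (𝓞 K)} (vbar : HeightOneSpectrum (𝓞 K))
    (κ : ZpExtension K p) (γ : absoluteGaloisGroup K) [Fact (κ.IsTopGenerator γ)]
    (Sf : Finset (HeightOneSpectrum (𝓞 K)))
    (hp2 : 2 < p) (hmult : Mult W p) (hns : ¬ W.HasSplitMultiplicativeReductionAtPrime p) (hred : Red W p)
    (hK : IsImaginaryQuadratic K) (hH : SatisfiesHeegnerHypothesis (W.conductorNorm ℤ) K)
    (hsplit : ((Ideal.span {(p : ℤ)}).primesOver (𝓞 K)).ncard = 2)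
    (hv : ((p : ℕ) : 𝓞 K) ∈ v.asIdeal) (hvbar : ((p : ℕ) : 𝓞 K) ∈ vbar.asIdeal) (hne : vbar ≠ v) (hκ : κ.IsAnticyclotomic)
    (hSf : ∀ w : HeightOneSpectrum (𝓞 K), w ∈ Sf ↔
      (((W.conductorNorm ℤ : ℤ) : 𝓞 K) ∈ w.asIdeal ∧ ((p : ℕ) : 𝓞 K) ∉ w.asIdeal))
    (θsub θquot : FramedGaloisRep K (padicCoeffIntegers (∅ : Set (PadicAlgCl p))) 1)
    (hpair : IsResidualPairOver (W.baseChange K) p θsub θquot)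
    (D0sub : GrDualData κ (charModule (∅ : Set (PadicAlgCl p)) θsub) vbar (∅ : Set (HeightOneSpectrum (𝓞 K))) γ)
    (D0quot : GrDualData κ (charModule (∅ : Set (PadicAlgCl p)) θquot) vbar (∅ : Set (HeightOneSpectrum (𝓞 K))) γ) :
    lambdaInvariant p D0sub.X + lambdaInvariant p D0quot.X +
        ∑ w ∈ Sf, (charLocalLambda (∅ : Set (PadicAlgCl p)) κ θsub w + charLocalLambda (∅ : Set (PadicAlgCl p)) κ θquot w) ≤
      lambdaInvariant p (XAc (W.baseChange K) p κ vbar (↑Sf : Set (HeightOneSpectrum (𝓞 K))) γ) := by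
  -- strict dual data at `Sf` exist unconditionally
  obtain ⟨Dsub⟩ := nonempty_grDualData_char (∅ : Set (PadicAlgCl p)) θsub κ vbar (↑Sf : Set (HeightOneSpectrum (𝓞 K)))
    (Fact.out : κ.IsTopGenerator γ)
  obtain ⟨Dquot⟩ := nonempty_grDualData_char (∅ : Set (PadicAlgCl p)) θquot κ vbar (↑Sf : Set (HeightOneSpectrum (𝓞 K)))
    (Fact.out : κ.IsTopGenerator γ)
  have halg := XAcImprimitiveNoPTorsion.lambdaInvariant_xAc_eq_add_of_not_split_of_facts hprop125 hfact hlift hlocal h411 h41 h42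
    h32 W K vbar κ γ Sf hp2 hmult hns hred hK hH hsplit hv hvbar hne hκ hSf θsub θquot hpair Dsub Dquot
  obtain ⟨-, -, -, -, hsub⟩ := charLambdaRelaxation_of_not_split_of_facts hprop125 hge W K vbar κ γ Sf hp2 hmult hns hK hH hsplit
    hvbar hκ hSf θsub θquot hpair θsub (Or.inl rfl) Dsub D0sub
  obtain ⟨-, -, -, -, hquot⟩ := charLambdaRelaxation_of_not_split_of_facts hprop125 hge W K vbar κ γ Sf hp2 hmult hns hK hH hsplit
    hvbar hκ hSf θsub θquot hpair θquot (Or.inr rfl) Dquot D0quot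
  rw [Finset.sum_add_distrib, halg]
  omega

end Summit.BirchSwinnertonDyer.BirchSwinnertonDyer.Theorems.CharGrSelmerLambdaRelaxation

end
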